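import Summits.BirchSwinnertonDyer.BirchSwinnertonDyer.Theorems.KimAtThreeDeepUpperUnitMinusSymbolAnyLevel
import HarnessLib

/-!
# The certificate supply (C2₃′) of the Kolyvagin-system road at a good / multiplicative `3` — CLASS-WIDE,
# from surj(3) alone (cell `bsd-addord`, seat w2-c3 gen 6; route W2 `KimAtThreeKolyvagin`, crux 19076
# `DeepUpperAtThree`, child 19562 `DeepUpperAtThreeOffKatoStratum` — its non-additive rows)

HONEST FRAMING: theorems only (no definition, no named fact, no `sorry`); nothing is booked; BSD is not proved.

## What, and why

This seat's `KimAtThreeDeepUpperNonAdditiveAllOfFineKato` (p484461) proves 19562's registered stub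
`stub_nonAdditive` VERBATIM from S24-DEEP ×2 + GZK + PT + (C1₃) + (C2₃′), where (C2₃′) is the CERTIFICATE
SUPPLY off the additive locus: Kato's auxiliary datum `(c, d, a, A, d′, aM)` with the usual guards, the cusp
certificate `v₃(R⁻) = 0` and the depletion certificate `v₃(∏_{q∣3A}E_q(1)) = α − 1` for some `α : ℕ`.
Its Kato-stratum twin (C2)/(C2′) is a THEOREM (gen 4 `unitMinusSymbol_classwide`, kim3
`certSupply_row_of_unitMinusSymbol`), but both used the additive prime: the Chebotarev progression step
needed `3 ∣ N ∣ γ` (to force `q ≡ δ ≡ 2 (mod 3)`), the Euler-product step `9 ∣ N` (`a₃ = 0`).  The companion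
`KimAtThreeDeepUpperUnitMinusSymbolAnyLevel` removes the first use (`unitMinusSymbol_row₃`); this file the second,
so (C2₃′) is a THEOREM and the non-additive rows of 19562 rest on (C1₃) ALONE:
* `certSupply_row_of_unitMinusSymbol₃` — kim3's row reduction with `aM 3 := a₃(W)`: depletion certificate
  `v₃(3 − a₃ + 𝟙_{3∤N}) − 1`;
* ★ `certSupply₃'` — (C2₃′) of `KimAtThreeDeepUpperNonAdditiveAllOfFineKato` VERBATIM, class-wide
  (`3 − a₃ + 𝟙 ≠ 0` from `a₃² ≤ 12` and, at `3 ∣ N`, `|a₃| < 3`).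
References: [Manin1972] Prop. 1.4 / Thm. 1.6; [TateGCFT1967] §2.4; [Kato2004Asterisque] Thm. 6.6 (1), Ex. 13.3;
[SilvermanAEC2009] Thm. V.1.1, Ex. 8.19 (a); gen-4 memo W2C3-C2PRIME-CLASSWIDE-g4.md.
-/

-- the cell's Theorems namespace repeats the summit name by design (D-0017)
set_option linter.dupNamespace false

noncomputable section

open scoped NumberField TensorProduct Classical MatrixGroups
open Field Finset IsDedekindDomain NumberField WeierstrassCurve Rat.HeightOneSpectrum
open Literature.NumberTheory.GaloisRepresentations Literature.NumberTheory.GaloisCohomology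
open Literature.NumberTheory.GaloisRepresentations.DiscreteGaloisModule
open Literature.NumberTheory.EllipticCurves Literature.NumberTheory.EllipticCurves.ModularForms
open Literature.NumberTheory.EllipticCurves.Rank1Residual
open Literature.NumberTheory.EllipticCurves.Kato2004
open Literature.NumberTheory.EllipticCurves.Kato2004.EulerSystemValues
open Summit.BirchSwinnertonDyer.Rank1Residual.GaloisImage
open Summit.BirchSwinnertonDyer.BirchSwinnertonDyer.Theorems
open Summit.BirchSwinnertonDyer.BirchSwinnertonDyer.Theorems.KimAtThreeKolyvaginPortSharedCert
open Summit.BirchSwinnertonDyer.BirchSwinnertonDyer.Theorems.KimAtThreeDeepUpperUnitMinusSymbolAnyLevel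

namespace Summit.BirchSwinnertonDyer.BirchSwinnertonDyer.Theorems.KimAtThreeDeepUpperCertSupplyNonAdditive

/-! ### §1 Kato's auxiliary datum with certificates from one unit minus symbol, any `a₃` -/

/-- **(C2) at a row from ONE unit minus modular symbol — ANY reduction type at `3`** (kim3's
`certSupply_row_of_unitMinusSymbol` needed `9 ∣ N`, i.e. `a₃(f) = 0`): the same Kato auxiliary cusp datum
`(c, d, a, A, d′, aM)` (`A = q^n`, `aM 3 := a₃(W)`, `aM q := a_q`), every guard, the cusp certificate
`v₃(R⁻) = 0`, and the depletion certificate `v₃(∏_{m ∣ 3A}(1 − aM m/m + 𝟙_{m∤N}/m)) = α′ − 1` with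
`α′ := v₃(3 − a₃(W) + 𝟙_{3∤N})` (the factor at `3` is `(3 − a₃ + 𝟙_{3∤N})/3`, at `q` it is
`(q + 1 − a_q)/q`, a `3`-unit); displayed: `3 − a₃(W) + 𝟙_{3∤N} ≠ 0` (true for every curve: `|a₃| ≤ 3`,
and `|a₃| < 3` when `3 ∣ N`). [cite: Kato2004Asterisque, Thm. 6.6 (1) (p. 163) and Ex. 13.3 (pp. 224–225)] -/
theorem certSupply_row_of_unitMinusSymbol₃
    (W : WeierstrassCurve ℚ) [W.IsElliptic] {N : ℕ} [NeZero N] (P : ModularParametrizationData W N)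
    (hE3 : (3 : ℤ) - W.LFunction 3 + (if 3 ∣ N then 0 else 1) ≠ 0)
    {q n : ℕ} (hq : q.Prime) (hq3 : q % 3 = 2) (hqN : ¬ q ∣ N) (hn : 1 ≤ n)
    {t : ℤ} (ht : cuspCoeff P.f q = t) (h3t : ¬ (3 : ℤ) ∣ (q : ℤ) + 1 - t)
    {a₀ : ℤ} (hX0 : ratMinusSymbol P.f ((a₀ : ℚ) / ((q ^ n : ℕ) : ℚ)) ≠ 0)
    (hX : padicValRat 3 (ratMinusSymbol P.f ((a₀ : ℚ) / ((q ^ n : ℕ) : ℚ))) = 0) :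
    ∃ (c d a : ℤ) (A : ℕ) (d' : ℤ) (aM : ℕ → ℤ) (α' : ℕ),
      0 < A ∧ Int.gcd c (6 * 3 * A) = 1 ∧ Int.gcd d (6 * 3 * N) = 1 ∧
      (∀ q : ℕ, q.Prime → q ≡ 1 [MOD 3] → ¬ q ∣ 2 * c.natAbs * d.natAbs * A) ∧
      Int.gcd (c * d) A = 1 ∧ d * d' ≡ 1 [ZMOD (A : ℤ)] ∧ Nat.Coprime A N ∧
      (∀ q ∈ (3 * A).primeFactors, cuspCoeff P.f q = aM q) ∧
      (∏ q ∈ (3 * A).primeFactors,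
          (1 - (aM q : ℚ) / q + (if q ∣ N then 0 else (1 / q : ℚ))) ≠ 0) ∧
      padicValRat 3 (∏ q ∈ (3 * A).primeFactors,
          (1 - (aM q : ℚ) / q + (if q ∣ N then 0 else (1 / q : ℚ)))) = (α' : ℤ) - 1 ∧
      ((c : ℚ) ^ 2 * (d : ℚ) ^ 2 * ratMinusSymbol P.f ((a : ℚ) / A) -
          (c : ℚ) * (d : ℚ) ^ 2 * ratMinusSymbol P.f ((a * c : ℚ) / A) -
          (c : ℚ) ^ 2 * (d : ℚ) * ratMinusSymbol P.f ((a * d' : ℚ) / A) +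
          (c : ℚ) * (d : ℚ) * ratMinusSymbol P.f ((a * c * d' : ℚ) / A) ≠ 0) ∧
      padicValRat 3 ((c : ℚ) ^ 2 * (d : ℚ) ^ 2 * ratMinusSymbol P.f ((a : ℚ) / A) -
          (c : ℚ) * (d : ℚ) ^ 2 * ratMinusSymbol P.f ((a * c : ℚ) / A) -
          (c : ℚ) ^ 2 * (d : ℚ) * ratMinusSymbol P.f ((a * d' : ℚ) / A) +
          (c : ℚ) * (d : ℚ) * ratMinusSymbol P.f ((a * c * d' : ℚ) / A)) = 0 := by
  set A : ℕ := q ^ n with hA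
  have hA0 : 0 < A := pow_pos hq.pos n
  have hq3' : ¬ 3 ∣ q := by omega
  have hq3ne : q ≠ 3 := by omega
  have hA3 : ¬ 3 ∣ A := fun h => hq3' (Nat.prime_three.dvd_of_dvd_pow h)
  have hN0 : 0 < N := Nat.pos_of_ne_zero (NeZero.ne N)
  -- the auxiliary primes `c`, `d`
  obtain ⟨c, hcB, hcp, hc1, hc2⟩ := exists_prime_gt_modEq_one_modEq_two hA0 hA3 (6 * 3 * A * N)
  obtain ⟨d, hdB, hdp, hd1, hd2⟩ := exists_prime_gt_modEq_one_modEq_two hA0 hA3 (6 * 3 * A * N)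
  have hc3 : c % 3 = 2 := by unfold Int.ModEq at hc2; omega
  have hd3 : d % 3 = 2 := by unfold Int.ModEq at hd2; omega
  have hc0 : (c : ℚ) ≠ 0 := by exact_mod_cast hcp.ne_zero
  have hd0 : (d : ℚ) ≠ 0 := by exact_mod_cast hdp.ne_zero
  have hc1' : (c : ℚ) - 1 ≠ 0 := sub_ne_zero.mpr (by exact_mod_cast hcp.one_lt.ne')
  have hd1' : (d : ℚ) - 1 ≠ 0 := sub_ne_zero.mpr (by exact_mod_cast hdp.one_lt.ne')
  have hAQ : (A : ℚ) ≠ 0 := by exact_mod_cast hA0.ne'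
  -- the symbol and its translates
  set X₁ := ratMinusSymbol P.f ((a₀ : ℚ) / (A : ℚ)) with hX₁
  obtain ⟨k, hk⟩ := hc1.symm.dvd
  have hcq : (c : ℚ) = (A : ℚ) * (k : ℚ) + 1 := by
    have : (c : ℤ) = (A : ℤ) * k + 1 := by linarith
    exact_mod_cast this
  have hX2 : ratMinusSymbol P.f (((a₀ : ℤ) : ℚ) * ((c : ℤ) : ℚ) / (A : ℚ)) = X₁ := by
    have : ((a₀ : ℤ) : ℚ) * ((c : ℤ) : ℚ) / (A : ℚ) = (a₀ : ℚ) / (A : ℚ) + ((a₀ * k : ℤ) : ℚ) := by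
      push_cast
      rw [hcq]
      field_simp
      ring
    rw [this, ratMinusSymbol_add_intCast]
  have hX3 : ratMinusSymbol P.f (((a₀ : ℤ) : ℚ) * ((1 : ℤ) : ℚ) / (A : ℚ)) = X₁ := by
    rw [Int.cast_one, mul_one]
  have hX4 : ratMinusSymbol P.f (((a₀ : ℤ) : ℚ) * ((c : ℤ) : ℚ) * ((1 : ℤ) : ℚ) / (A : ℚ)) = X₁ := by
    rw [Int.cast_one, mul_one, hX2]
  -- the four-term factor collapses
  have hR : ((c : ℤ) : ℚ) ^ 2 * ((d : ℤ) : ℚ) ^ 2 * ratMinusSymbol P.f (((a₀ : ℤ) : ℚ) / (A : ℚ)) -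
      ((c : ℤ) : ℚ) * ((d : ℤ) : ℚ) ^ 2 * ratMinusSymbol P.f (((a₀ : ℤ) : ℚ) * ((c : ℤ) : ℚ) / (A : ℚ)) -
      ((c : ℤ) : ℚ) ^ 2 * ((d : ℤ) : ℚ) * ratMinusSymbol P.f (((a₀ : ℤ) : ℚ) * ((1 : ℤ) : ℚ) / (A : ℚ)) +
      ((c : ℤ) : ℚ) * ((d : ℤ) : ℚ) *
        ratMinusSymbol P.f (((a₀ : ℤ) : ℚ) * ((c : ℤ) : ℚ) * ((1 : ℤ) : ℚ) / (A : ℚ)) =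
      (c : ℚ) * (d : ℚ) * ((c : ℚ) - 1) * ((d : ℚ) - 1) * X₁ := by
    rw [hX2, hX3, hX4]
    push_cast
    ring
  have hRne : (c : ℚ) * (d : ℚ) * ((c : ℚ) - 1) * ((d : ℚ) - 1) * X₁ ≠ 0 :=
    mul_ne_zero (mul_ne_zero (mul_ne_zero (mul_ne_zero hc0 hd0) hc1') hd1') hX0
  have hv3c : padicValRat 3 (c : ℚ) = 0 := by
    rw [padicValRat.of_nat]
    exact_mod_cast padicValNat.eq_zero_of_not_dvd (by omega : ¬ 3 ∣ c)
  have hv3d : padicValRat 3 (d : ℚ) = 0 := by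
    rw [padicValRat.of_nat]
    exact_mod_cast padicValNat.eq_zero_of_not_dvd (by omega : ¬ 3 ∣ d)
  have hv3c1 : padicValRat 3 ((c : ℚ) - 1) = 0 := by
    rw [show (c : ℚ) - 1 = (((c : ℤ) - 1 : ℤ) : ℚ) by push_cast; ring, padicValRat.of_int]
    exact_mod_cast padicValInt.eq_zero_of_not_dvd (by omega : ¬ (3 : ℤ) ∣ (c : ℤ) - 1)
  have hv3d1 : padicValRat 3 ((d : ℚ) - 1) = 0 := by
    rw [show (d : ℚ) - 1 = (((d : ℤ) - 1 : ℤ) : ℚ) by push_cast; ring, padicValRat.of_int]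
    exact_mod_cast padicValInt.eq_zero_of_not_dvd (by omega : ¬ (3 : ℤ) ∣ (d : ℤ) - 1)
  have hRval : padicValRat 3 ((c : ℚ) * (d : ℚ) * ((c : ℚ) - 1) * ((d : ℚ) - 1) * X₁) = 0 := by
    rw [padicValRat.mul (mul_ne_zero (mul_ne_zero (mul_ne_zero hc0 hd0) hc1') hd1') hX0,
      padicValRat.mul (mul_ne_zero (mul_ne_zero hc0 hd0) hc1') hd1',
      padicValRat.mul (mul_ne_zero hc0 hd0) hc1', padicValRat.mul hc0 hd0,
      hv3c, hv3d, hv3c1, hv3d1, hX]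
    norm_num
  -- the prime factors of `3A`
  have hpf : (3 * A).primeFactors = {3, q} := by
    rw [Nat.primeFactors_mul (by norm_num) hA0.ne', Nat.Prime.primeFactors Nat.prime_three, hA,
      Nat.primeFactors_prime_pow (by omega) hq, ← Finset.insert_eq]
  have h3q : (3 : ℕ) ≠ q := fun h => hq3ne h.symm
  have ha3 : cuspCoeff P.f 3 = ((W.LFunction 3 : ℤ) : ℂ) := P.isNewformOf.2 3
  -- the Euler product: the factor at `3` is `(3 − a₃ + 𝟙_{3∤N})/3`, at `q` it is `(q + 1 − a_q)/q`
  set e₃ : ℤ := 3 - W.LFunction 3 + (if 3 ∣ N then 0 else 1) with he₃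
  set aM : ℕ → ℤ := fun m => if m = q then t else W.LFunction 3 with haM
  have haM3 : aM 3 = W.LFunction 3 := by rw [haM]; simp [hq3ne.symm]
  have haMq : aM q = t := by rw [haM]; simp
  have hnum : ((q : ℤ) + 1 - t : ℤ) ≠ 0 := fun h => h3t (h ▸ dvd_zero 3)
  have hprod : ∏ m ∈ (3 * A).primeFactors,
      (1 - (aM m : ℚ) / m + (if m ∣ N then 0 else (1 / m : ℚ))) =
        ((e₃ : ℤ) : ℚ) / 3 * ((((q : ℤ) + 1 - t : ℤ) : ℚ) / (q : ℚ)) := by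
    rw [hpf, Finset.prod_pair h3q, haM3, haMq, if_neg hqN, he₃]
    have hq0 : (q : ℚ) ≠ 0 := by exact_mod_cast hq.ne_zero
    by_cases h3N : 3 ∣ N
    · rw [if_pos h3N, if_pos h3N]
      push_cast
      field_simp
      ring
    · rw [if_neg h3N, if_neg h3N]
      push_cast
      field_simp
      ring
  refine ⟨c, d, a₀, A, 1, aM, (padicValInt 3 e₃), hA0, ?_, ?_, ?_, ?_, ?_, ?_, ?_, ?_, ?_, ?_, ?_⟩
  · -- `(c, 18A) = 1`
    rw [show (6 * 3 * (A : ℤ) : ℤ) = ((6 * 3 * A : ℕ) : ℤ) by push_cast; ring]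
    exact int_gcd_natCast_eq_one_of_prime_of_lt hcp (by positivity) (by nlinarith)
  · -- `(d, 18N) = 1`
    rw [show (6 * 3 * (N : ℤ) : ℤ) = ((6 * 3 * N : ℕ) : ℤ) by push_cast; ring]
    exact int_gcd_natCast_eq_one_of_prime_of_lt hdp (by positivity) (by nlinarith)
  · -- `hcdA`: the primes dividing `2cdA` are `2, c, d, q`, none `≡ 1 (mod 3)`
    intro r hr hr1 hdvd
    rw [Int.natAbs_natCast, Int.natAbs_natCast] at hdvd
    have hr3 : r % 3 = 1 := hr1
    rcases (Nat.Prime.dvd_mul hr).mp hdvd with h | h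
    · rcases (Nat.Prime.dvd_mul hr).mp h with h | h
      · rcases (Nat.Prime.dvd_mul hr).mp h with h | h
        · have := (Nat.prime_dvd_prime_iff_eq hr Nat.prime_two).mp h; omega
        · have := (Nat.prime_dvd_prime_iff_eq hr hcp).mp h; omega
      · have := (Nat.prime_dvd_prime_iff_eq hr hdp).mp h; omega
    · have := (Nat.prime_dvd_prime_iff_eq hr hq).mp (hr.dvd_of_dvd_pow h); omega
  · -- `(cd, A) = 1`
    obtain ⟨k', hk'⟩ := (hc1.mul hd1).symm.dvd
    refine Int.isCoprime_iff_gcd_eq_one.mp ⟨1, -k', ?_⟩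
    linear_combination hk'
  · -- `d · 1 ≡ 1 (mod A)`
    simpa using hd1
  · -- `(A, N) = 1`
    exact Nat.Coprime.pow_left n ((Nat.Prime.coprime_iff_not_dvd hq).mpr hqN)
  · -- integer models of `a_3(f) = a₃(W)` and `a_q(f) = t`
    intro m hm
    rw [hpf, Finset.mem_insert, Finset.mem_singleton] at hm
    rcases hm with rfl | rfl
    · rw [ha3, haM3]
    · rw [ht, haMq]
  · -- Euler product non-zero
    rw [hprod]
    exact mul_ne_zero (div_ne_zero (by exact_mod_cast hE3) three_ne_zero)
      (div_ne_zero (by exact_mod_cast hnum) (by exact_mod_cast hq.ne_zero))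
  · -- Euler product of valuation `v₃(e₃) − 1`
    have he0 : ((e₃ : ℤ) : ℚ) ≠ 0 := by exact_mod_cast hE3
    rw [hprod, padicValRat.mul (div_ne_zero he0 three_ne_zero)
      (div_ne_zero (by exact_mod_cast hnum) (by exact_mod_cast hq.ne_zero)),
      padicValRat.div he0 three_ne_zero,
      padicValRat.div (by exact_mod_cast hnum) (by exact_mod_cast hq.ne_zero),
      padicValRat.of_int, padicValRat.of_int, padicValRat.of_nat, padicValInt.eq_zero_of_not_dvd h3t,
      padicValNat.eq_zero_of_not_dvd hq3']
    have h3 : padicValRat 3 (3 : ℚ) = 1 := by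
      have h := @padicValRat.self 3 (by norm_num : 1 < 3)
      simpa using h
    rw [h3]
    push_cast
    ring
  · -- `R⁻ ≠ 0`
    rw [hR]; exact hRne
  · -- `R⁻` a `3`-unit
    rw [hR]; exact hRval

/-! ### §2 ★ (C2₃′) class-wide -/

/-- `3 − a₃(W) + 𝟙_{3∤N} ≠ 0` for the newform level `N` of `W`: `a₃(W)² ≤ 12` (Hasse), and `|a₃(W)| < 3`
when `3 ∣ N`. [cite: SilvermanAEC2009, Thm. V.1.1] -/
theorem three_sub_LFunction_add_ne_zero (W : WeierstrassCurve ℚ) [W.IsElliptic] {N : ℕ} [NeZero N]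
    (P : ModularParametrizationData W N) :
    (3 : ℤ) - W.LFunction 3 + (if 3 ∣ N then 0 else 1) ≠ 0 := by
  by_cases h3N : 3 ∣ N
  · rw [if_pos h3N, add_zero]
    have h := abs_LFunction_prime_lt_of_dvd_level P.isNewformOf Nat.prime_three h3N
    have h' : (W.LFunction 3 : ℝ) < 3 := lt_of_le_of_lt (le_abs_self _) (by exact_mod_cast h)
    have h'' : W.LFunction 3 < 3 := by exact_mod_cast h'
    omega
  · rw [if_neg h3N]
    have h := sq_LFunction_prime_le W Nat.prime_three
    have h' : (W.LFunction 3 : ℤ) ^ 2 ≤ 12 := by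
      have : ((W.LFunction 3 : ℤ) : ℝ) ^ 2 ≤ 4 * (3 : ℕ) := h
      norm_num at this
      exact_mod_cast this
    have h'' : W.LFunction 3 ≤ 3 := by
      by_contra hc
      push Not at hc
      nlinarith
    omega

/-- ★ **(C2₃′) — the certificate supply of `KimAtThreeDeepUpperNonAdditiveAllOfFineKato` VERBATIM, as a
theorem** (indeed for every `W` with `ρ̄_{E,3}` onto — from the tower at `m = 1` — and every datum `P`; the
`¬ Addv` and lattice binders are not used): `unitMinusSymbol_row₃` ∘ `certSupply_row_of_unitMinusSymbol₃`.
[cite: Kato2004Asterisque, Thm. 6.6 (1) (p. 163) and Ex. 13.3 (pp. 224–225)] [cite: TateGCFT1967, §2.4 (Tchebotarev density theorem)] -/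
theorem certSupply₃' :
    ∀ (W : WeierstrassCurve ℚ) [W.IsElliptic] [W.IsGloballyMinimal],
    (∀ m : ℕ, W.HasSurjectiveModNGaloisRep (3 ^ m : ℕ)) →
    ¬ (haveI : Fact (Nat.Prime 3) := ⟨Nat.prime_three⟩; Addv W 3) →
    ∀ {N : ℕ} [NeZero N] (P : ModularParametrizationData W N), N = W.conductorNorm ℤ →
      (∀ z ∈ P.L.lattice, ∃ w ∈ periodLattice P.f, z = P.c * w) →
      ∃ (c d a : ℤ) (A : ℕ) (d' : ℤ) (aM : ℕ → ℤ) (α : ℕ),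
        0 < A ∧ Int.gcd c (6 * 3 * A) = 1 ∧ Int.gcd d (6 * 3 * N) = 1 ∧
        (∀ q : ℕ, q.Prime → q ≡ 1 [MOD 3] → ¬ q ∣ 2 * c.natAbs * d.natAbs * A) ∧
        Int.gcd (c * d) A = 1 ∧ d * d' ≡ 1 [ZMOD (A : ℤ)] ∧ Nat.Coprime A N ∧
        (∀ q ∈ (3 * A).primeFactors, cuspCoeff P.f q = aM q) ∧
        (∏ q ∈ (3 * A).primeFactors,
            (1 - (aM q : ℚ) / q + (if q ∣ N then 0 else (1 / q : ℚ))) ≠ 0) ∧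
        padicValRat 3 (∏ q ∈ (3 * A).primeFactors,
            (1 - (aM q : ℚ) / q + (if q ∣ N then 0 else (1 / q : ℚ)))) = (α : ℤ) - 1 ∧
        ((c : ℚ) ^ 2 * (d : ℚ) ^ 2 * ratMinusSymbol P.f ((a : ℚ) / A) -
            (c : ℚ) * (d : ℚ) ^ 2 * ratMinusSymbol P.f ((a * c : ℚ) / A) -
            (c : ℚ) ^ 2 * (d : ℚ) * ratMinusSymbol P.f ((a * d' : ℚ) / A) +
            (c : ℚ) * (d : ℚ) * ratMinusSymbol P.f ((a * c * d' : ℚ) / A) ≠ 0) ∧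
        padicValRat 3 ((c : ℚ) ^ 2 * (d : ℚ) ^ 2 * ratMinusSymbol P.f ((a : ℚ) / A) -
            (c : ℚ) * (d : ℚ) ^ 2 * ratMinusSymbol P.f ((a * c : ℚ) / A) -
            (c : ℚ) ^ 2 * (d : ℚ) * ratMinusSymbol P.f ((a * d' : ℚ) / A) +
            (c : ℚ) * (d : ℚ) * ratMinusSymbol P.f ((a * c * d' : ℚ) / A)) = 0 := by
  intro W _ _ htow _ N _ P _ _
  have hs : W.HasSurjectiveModNGaloisRep (3 : ℕ) := by simpa using htow 1
  obtain ⟨q, n, t, a₀, hq, hq3, hqN, hn, ht, h3t, hX0, hX⟩ := unitMinusSymbol_row₃ W hs P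
  exact certSupply_row_of_unitMinusSymbol₃ W P (three_sub_LFunction_add_ne_zero W P) hq hq3 hqN hn ht h3t
    hX0 hX

end Summit.BirchSwinnertonDyer.BirchSwinnertonDyer.Theorems.KimAtThreeDeepUpperCertSupplyNonAdditive

end
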